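import Summits.AnomalousDissipation.AnomalousDissipation.Theses.LimitingAbsorption
import Literature.Analysis.FluidPDE.SeisDissipationRateBound

/-!
# Sketch — typed statements behind the round-1 negative brief of ideator 1 for the crux
`LimitingAbsorption.RelaxingFamily` (stmt-AnomalousDissipation-15009).  Statements only
(elaboration check, no proofs); they are DISPROOF TARGETS / tools for the cdisprove seat and the
first lemmas a negative line would register, not thesis-side stubs.

* `RelaxingFamilyUnder Hyp` — the crux with an extra hypothesis on the witness (the shape of every
  `RelaxingFamily_false_without_…` / refuted-strengthening theorem).
* `CollinearTorque`, `collinearTorque_noGo` — port of 2937-N1 (`NoUniversalRelaxer`): if the released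
  profile `h` is a multiple of the planar curl of the force, the Pr = 1 Duhamel identity for the
  vorticity + Seis 2022 Thm 2 refute the crux.
* `UniformEnstrophy`, `uniformEnstrophy_noGo` — Seis 2022 Rmk 1 directly: no witness with
  `j`-uniformly bounded windowed enstrophy (kills every band-limited / Galerkin / single-shell /
  Gallet–Young-condensate design at once).
* `MaterialRateComparison` — the rigorous core of the "vorticity is an L²-quasi-material invariant"
  step of the squeeze: a sourced weak scalar and the unsourced one released from the same slice drift
  apart in `L²` at most linearly, `‖ω(s+t) − ϑ(t)‖₂ ≤ t‖f‖₂` (provable now: difference solves the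
  sourced equation from zero datum; energy inequality + Minkowski).
-/

namespace Summit.AnomalousDissipation.AnomalousDissipation.Cruxes.RelaxingFamily.Ideator1

open MeasureTheory Filter Topology Set
open Literature.Analysis.FunctionSpaces Literature.Analysis.FluidPDE

local notation "𝕋²" => UnitAddTorus (Fin 2)
local notation "E²" => EuclideanSpace ℝ (Fin 2)

/-- The planar scalar curl `∂₀w₁ − ∂₁w₀` through `Torus.gradient` of the components (same four-line
definition as the sibling sketches; a tree-level `Torus.planarCurl` is a filed definition want). -/
noncomputable def planarCurl (w : 𝕋² → E²) (x : 𝕋²) : ℝ :=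
  Torus.gradient (fun y => w y 1) x 0 - Torus.gradient (fun y => w y 0) x 1

/-- Phase-uniform, `ν`-uniform exponential relaxation of the profile `h` along the family
`(ν, v)` with constants `(C, γ)` — the (U_h) clause of the crux, verbatim. -/
def RelaxesUniformly (ν : ℕ → ℝ) (v : ℕ → ℝ → 𝕋² → E²) (h : 𝕋² → ℝ) (C γ : ℝ) : Prop :=
  ∀ (j : ℕ) (s : ℝ), 0 ≤ s → ∀ (T : ℝ) (θ : ℝ → 𝕋² → ℝ),
    Torus.IsWeakScalarTransportOn T (ν j) (fun t => v j (s + t)) h θ →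
      ∀ᵐ t ∂(volume.restrict (Ioo (0 : ℝ) T)),
        Torus.scalarL2Sq (θ t) ≤ C * Real.exp (-(γ * t)) * Torus.scalarL2Sq h

/-- The crux `RelaxingFamily` with an EXTRA hypothesis `Hyp g h ν v` on the witness: the common shape
of refuted strengthenings (`¬ RelaxingFamilyUnder Hyp` = "any proof must leave the class `Hyp`"). -/
def RelaxingFamilyUnder
    (Hyp : (𝕋² → E²) → (𝕋² → ℝ) → (ℕ → ℝ) → (ℕ → ℝ → 𝕋² → E²) → Prop) : Prop :=
  ∃ (g : 𝕋² → E²) (h : 𝕋² → ℝ), Torus.IsSmooth g ∧ Torus.IsDivFree g ∧ Torus.HasZeroMean g ∧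
    Torus.IsSmooth h ∧ Torus.HasZeroMean h ∧ h ≠ 0 ∧
    ∃ (ν : ℕ → ℝ) (v₀ : ℕ → 𝕋² → E²) (v : ℕ → ℝ → 𝕋² → E²),
      (∀ j, 0 < ν j) ∧ Tendsto ν atTop (𝓝 0) ∧
      (∀ j, Torus.IsGlobalLerayHopf (ν j) (fun _ => g) (v₀ j) (v j)) ∧
      (∀ j (T : ℝ), 0 < T →
        MemLp (Torus.stLift (v j)) ⊤ (volume.restrict (Ioo (0 : ℝ) T ×ˢ univ))) ∧
      (∃ E : ℝ, ∀ j, meanEnergy (v j) ≤ E) ∧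
      Hyp g h ν v ∧
      ∃ C γ : ℝ, 0 ≤ C ∧ 0 < γ ∧ RelaxesUniformly ν v h C γ

/-- Sanity: with the trivial extra hypothesis this is the crux itself. -/
theorem relaxingFamilyUnder_true_iff :
    RelaxingFamilyUnder (fun _ _ _ _ => True) ↔
      Summit.AnomalousDissipation.AnomalousDissipation.Theses.LimitingAbsorption.RelaxingFamily := by
  unfold RelaxingFamilyUnder RelaxesUniformly
    Summit.AnomalousDissipation.AnomalousDissipation.Theses.LimitingAbsorption.RelaxingFamily
  simp only [true_and]

/-- Extra hypothesis "the released profile is collinear with the torque": `h = c · curl g`. -/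
def CollinearTorque (g : 𝕋² → E²) (h : 𝕋² → ℝ) (_ν : ℕ → ℝ) (_v : ℕ → ℝ → 𝕋² → E²) : Prop :=
  ∃ c : ℝ, ∀ x, h x = c * planarCurl g x

/-- **Disproof target T1 (port of 2937-N1 `NoUniversalRelaxer` / 0211 `CollinearSourceNoAnomaly`).**
At Pr = 1 the planar vorticity `ω_j = curl v_j` is a weak solution of the crux's OWN scalar equation with
source `curl g`; Duhamel (`ω_j(t) = P_j(t,s)ω_j(s) + ∫ₛᵗ P_j(t,τ) curl g dτ`, Poincaré decay of the memory
term at fixed `j`) turns (U_{c·curl g}) = (U_h) into a `j`-uniform late-time enstrophy bound, and the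
vendored `Seis2022_thm2_L2` (after the time rescaling of its scaling note) caps `γ ≤ M K / log(M/ν_j) → 0`. -/
def collinearTorque_noGo : Prop :=
  Seis2022_thm2_L2 → ¬ RelaxingFamilyUnder CollinearTorque

/-- Extra hypothesis "uniformly bounded windowed enstrophy from some phase on": for every `j` there is
a phase `s_j` after which `‖∇v_j(t)‖²₂ ≤ Z` for a.e. `t`, with `Z` independent of `j`. -/
def UniformEnstrophy (_g : 𝕋² → E²) (_h : 𝕋² → ℝ) (_ν : ℕ → ℝ) (v : ℕ → ℝ → 𝕋² → E²) : Prop :=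
  ∃ Z : ℝ, ∀ j, ∃ s : ℝ, 0 ≤ s ∧
    ∀ᵐ t ∂(volume.restrict (Ioi (0 : ℝ))), Torus.eGradNormSq (v j (s + t)) ≤ ENNReal.ofReal Z

/-- **Disproof target T2 (Seis directly).**  No witness of the crux has `j`-uniformly bounded late
enstrophy: apply `Seis2022_thm2_L2` to the shifted field `v_j(s_j + ·)/√Z` and the datum `h`. Covers:
single-shell `g` (ShellPincer), every uniformly band-limited family (2937 Disproof §9–§11 analogues),
the Gallet–Young condensate regime, and any family converging to a smooth object in `H¹`. -/
def uniformEnstrophy_noGo : Prop :=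
  Seis2022_thm2_L2 → ¬ RelaxingFamilyUnder UniformEnstrophy

/-- **Tool T4: material-rate comparison (rigorous core of the Pr = 1 "vorticity is an L²-quasi-material
invariant" step).**  For a locally bounded drift `u`, diffusivity `κ > 0`, a steady `L²` source `f`: if
`ω` is a global weak solution of the SOURCED equation from datum `ω₀ ∈ L²` and `ϑ` a weak solution of the
UNSOURCED equation on `[0,T)` from the same datum, then `‖ω(t) − ϑ(t)‖₂ ≤ t‖f‖₂` for a.e. `t ∈ (0,T)`
(squared form below).  Applied with `u = v_j(s+·)`, `ω = curl v_j(s+·)`, `f = curl g`: the flow's own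
vorticity differs from a passively released copy of itself by `O(t)` in `L²`, uniformly in `j`, while
Seis forces `‖ω_j‖₂ ≳ γ log(1/ν_j)` — whatever the window map does to `h` it does to `ω_j(s)` up to `O(1)`. -/
def MaterialRateComparison : Prop :=
  ∀ (κ : ℝ) (u : ℝ → 𝕋² → E²) (f ω₀ : 𝕋² → ℝ) (ω ϑ : ℝ → 𝕋² → ℝ) (T : ℝ),
    0 < κ → MemLp f 2 volume → MemLp ω₀ 2 volume →
    (∀ T' : ℝ, 0 < T' → MemLp (Torus.stLift u) ⊤ (volume.restrict (Ioo (0 : ℝ) T' ×ˢ univ))) →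
    Torus.IsWeakScalarTransportForced κ u (fun _ => f) ω₀ ω →
    Torus.IsWeakScalarTransportOn T κ u ω₀ ϑ →
      ∀ᵐ t ∂(volume.restrict (Ioo (0 : ℝ) T)),
        Torus.scalarL2Sq (fun x => ω t x - ϑ t x) ≤ t ^ 2 * Torus.scalarL2Sq f

end Summit.AnomalousDissipation.AnomalousDissipation.Cruxes.RelaxingFamily.Ideator1
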